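import Mathlib

/-!
# Kernel-definite junction, part 8a: the seam scaling limit

Helper file for the stub `stub_kernelDefiniteJunction` of the line `junction_ceiling` (crux `MatrixDescartes`,
stmt-ValiantsHypothesis-18050).  At the SEAM scale `x = z^w`, `y = z^{-g} v` (`w = e 1 − e 0` the first gap of `Q`,
`g = d last − d last'` the last gap of `P`) the real matrix `𝓗(x, y) = ∑ x^{d l − d 0} S l + x^{ã} ∑ y^{e l − e 0} T l`
is conjugated by an orthogonal `U` diagonalising the junction letter `J = S last = U diag(λ) Uᵀ` and its rows are
rescaled by `z^{-w ã}` (rows with `λ_i ≠ 0`) resp. `z^{-w ã'}` (rows with `λ_i = 0`, `ã' = d last' − d 0`).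
`seam_scaled_det_tendsto`: the rescaled determinant `z^{-w n₀} det 𝓗(z^w, z^{-g} v)` (with
`n₀ = ∑_i (λ_i = 0 ? ã' : ã)`) converges, as `z → ∞`, to `det N∞(v)` where `N∞` has the diagonal rows `λ_i δ_ik`
for `λ_i ≠ 0` and the rows of `Uᵀ (S last' + v^w T 1) U` for `λ_i = 0`.  Part 8b turns this into the seam datum of
the Newton chain. [folklore] (two-scale perturbation of a symmetric pencil at a singular letter; elementary limits.)
-/

-- `Summit.ValiantsHypothesis.ValiantsHypothesis.…` is the tree's mandated single-conjunct layout (Sub = Summit).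
set_option linter.dupNamespace false
set_option autoImplicit false

namespace Summit.ValiantsHypothesis.ValiantsHypothesis.Theorems.LacunarySymmetroidMatrixDescartes.JunctionCeiling

open Polynomial Finset Matrix Filter Topology
open scoped BigOperators

/-! ## 1. Elementary limits `c z^p / z^q` -/

/-- `c z^p / z^q → 0` for `p < q`. [folklore] -/
theorem tendsto_term_of_lt (c : ℝ) {p q : ℕ} (h : p < q) :
    Tendsto (fun z : ℝ => c * z ^ p * (z ^ q)⁻¹) atTop (𝓝 0) := by
  obtain ⟨r, rfl⟩ := Nat.exists_eq_add_of_lt h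
  have h1 : Tendsto (fun z : ℝ => (z ^ (r + 1))⁻¹) atTop (𝓝 0) :=
    tendsto_inv_atTop_zero.comp (tendsto_pow_atTop (by omega))
  have h2 : Tendsto (fun z : ℝ => c * (z ^ (r + 1))⁻¹) atTop (𝓝 (c * 0)) := h1.const_mul c
  rw [mul_zero] at h2
  refine h2.congr' ?_
  filter_upwards [eventually_gt_atTop 0] with z hz
  have hz0 : z ≠ 0 := hz.ne'
  field_simp
  ring

/-- `c z^p / z^p → c`. [folklore] -/
theorem tendsto_term_self (c : ℝ) (p : ℕ) :
    Tendsto (fun z : ℝ => c * z ^ p * (z ^ p)⁻¹) atTop (𝓝 c) := by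
  refine tendsto_const_nhds.congr' ?_
  filter_upwards [eventually_gt_atTop 0] with z hz
  rw [mul_assoc, mul_inv_cancel₀ (pow_ne_zero _ hz.ne'), mul_one]

/-- the common shape: `c z^p / z^q → (p = q ? c : 0)` whenever `p ≤ q` or `c = 0`. [folklore] -/
theorem tendsto_term (c : ℝ) (p q : ℕ) (h : p ≤ q ∨ c = 0) :
    Tendsto (fun z : ℝ => c * z ^ p * (z ^ q)⁻¹) atTop (𝓝 (if p = q then c else 0)) := by
  by_cases hpq : p = q
  · rw [if_pos hpq, hpq]; exact tendsto_term_self c q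
  · rw [if_neg hpq]
    rcases h with h | h
    · exact tendsto_term_of_lt c (lt_of_le_of_ne h hpq)
    · simp only [h, zero_mul]; exact tendsto_const_nhds

/-! ## 2. Orthogonal conjugation bookkeeping -/

/-- `det (Uᵀ M U) = det M` for `U Uᵀ = 1`. [folklore] -/
theorem det_conj_orthogonal {n : Type*} [Fintype n] [DecidableEq n] (U M : Matrix n n ℝ) (hU : U * Uᵀ = 1) :
    (Uᵀ * M * U).det = M.det := by
  have h := congrArg Matrix.det hU
  rw [det_mul, det_transpose, det_one] at h
  rw [det_mul, det_mul, det_transpose]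
  linear_combination M.det * h

/-- `Uᵀ J U = diag λ` from `J = U diag(λ) Uᵀ`, `U Uᵀ = 1`. [folklore] -/
theorem conj_eq_diagonal {n : Type*} [Fintype n] [DecidableEq n] (U J : Matrix n n ℝ) (lam : n → ℝ)
    (hU : U * Uᵀ = 1) (hJ : J = U * diagonal lam * Uᵀ) : Uᵀ * J * U = diagonal lam := by
  have hU' : Uᵀ * U = 1 := mul_eq_one_comm.1 hU
  rw [hJ, ← Matrix.mul_assoc, ← Matrix.mul_assoc, hU', Matrix.one_mul, Matrix.mul_assoc, hU', Matrix.mul_one]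

/-! ## 3. The seam scaling limit -/

section Seam

variable {m : ℕ} (K₁ K₂ : ℕ) (d : Fin (K₁ + 2) → ℕ) (S : Fin (K₁ + 2) → Matrix (Fin m) (Fin m) ℝ)
  (e : Fin (K₂ + 2) → ℕ) (T : Fin (K₂ + 2) → Matrix (Fin m) (Fin m) ℝ)
  (U : Matrix (Fin m) (Fin m) ℝ) (lam : Fin m → ℝ)

/-- entries of the conjugated real junction matrix `Uᵀ 𝓗(x, y) U`. [folklore] -/
theorem conj_realH_apply (x y : ℝ) (i k : Fin m) :
    (Uᵀ * (∑ l : Fin (K₁ + 2), x ^ (d l - d 0) • S l +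
        ∑ l : Fin (K₂ + 1), (x ^ (d (Fin.last (K₁ + 1)) - d 0) * y ^ (e l.succ - e 0)) • T l.succ) * U) i k =
      ∑ l : Fin (K₁ + 2), x ^ (d l - d 0) * (Uᵀ * S l * U) i k +
        ∑ l : Fin (K₂ + 1), (x ^ (d (Fin.last (K₁ + 1)) - d 0) * y ^ (e l.succ - e 0)) * (Uᵀ * T l.succ * U) i k := by
  simp only [Matrix.mul_add, Matrix.add_mul, Finset.mul_sum, Finset.sum_mul, Matrix.mul_smul, Matrix.smul_mul,
    Matrix.add_apply, Matrix.sum_apply, Matrix.smul_apply, smul_eq_mul]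

/-- **THE SEAM SCALING LIMIT.** [folklore] -/
theorem seam_scaled_det_tendsto (hd : StrictMono d) (he : StrictMono e) (hU : U * Uᵀ = 1)
    (hJ : S (Fin.last (K₁ + 1)) = U * diagonal lam * Uᵀ) (v : ℝ) :
    Tendsto (fun z : ℝ =>
      (∏ i, (z ^ ((e 1 - e 0) * (if lam i = 0 then d (Fin.last K₁).castSucc - d 0
          else d (Fin.last (K₁ + 1)) - d 0)))⁻¹) *
        (∑ l : Fin (K₁ + 2), (z ^ (e 1 - e 0)) ^ (d l - d 0) • S l +
          ∑ l : Fin (K₂ + 1), ((z ^ (e 1 - e 0)) ^ (d (Fin.last (K₁ + 1)) - d 0) *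
            ((z ^ (d (Fin.last (K₁ + 1)) - d (Fin.last K₁).castSucc))⁻¹ * v) ^ (e l.succ - e 0)) • T l.succ).det)
      atTop
      (𝓝 (Matrix.of (fun i k : Fin m => if lam i = 0
          then (Uᵀ * S (Fin.last K₁).castSucc * U) i k + v ^ (e 1 - e 0) * (Uᵀ * T 1 * U) i k
          else (if i = k then lam i else 0))).det) := by
  -- abbreviations
  set w : ℕ := e 1 - e 0 with hw
  set a : ℕ := d (Fin.last (K₁ + 1)) - d 0 with ha
  set a' : ℕ := d (Fin.last K₁).castSucc - d 0 with ha'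
  set g : ℕ := d (Fin.last (K₁ + 1)) - d (Fin.last K₁).castSucc with hg
  set ex : Fin m → ℕ := fun i => if lam i = 0 then a' else a with hex
  have hlast : (Fin.last K₁).castSucc < Fin.last (K₁ + 1) := Fin.castSucc_lt_last _
  have hg0 : 0 < g := Nat.sub_pos_of_lt (hd hlast)
  have hw0 : 0 < w := Nat.sub_pos_of_lt (he Fin.zero_lt_one)
  have haa' : a = a' + g := by
    have h1 : d 0 ≤ d (Fin.last K₁).castSucc := hd.monotone (Fin.zero_le _)
    have h2 : d (Fin.last K₁).castSucc ≤ d (Fin.last (K₁ + 1)) := (hd hlast).le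
    omega
  have hUU : Uᵀ * U = 1 := mul_eq_one_comm.1 hU
  have hdiag : Uᵀ * S (Fin.last (K₁ + 1)) * U = diagonal lam := conj_eq_diagonal U _ lam hU hJ
  -- Step 1: rewrite as the determinant of the row-scaled conjugated matrix
  have hstep : ∀ z : ℝ,
      (∏ i, (z ^ (w * ex i))⁻¹) *
        (∑ l : Fin (K₁ + 2), (z ^ w) ^ (d l - d 0) • S l +
          ∑ l : Fin (K₂ + 1), ((z ^ w) ^ a * ((z ^ g)⁻¹ * v) ^ (e l.succ - e 0)) • T l.succ).det =
      (Matrix.of fun i k : Fin m => (z ^ (w * ex i))⁻¹ *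
        (∑ l : Fin (K₁ + 2), (z ^ w) ^ (d l - d 0) * (Uᵀ * S l * U) i k +
          ∑ l : Fin (K₂ + 1), ((z ^ w) ^ a * ((z ^ g)⁻¹ * v) ^ (e l.succ - e 0)) * (Uᵀ * T l.succ * U) i k)).det := by
    intro z
    rw [← det_conj_orthogonal U _ hU, ← Matrix.det_mul_column]
    congr 1
    ext i k
    rw [Matrix.of_apply, Matrix.of_apply, conj_realH_apply]
  refine Tendsto.congr (fun z => (hstep z).symm) ?_
  -- Step 2: entrywise limits
  suffices hN : Tendsto (fun z : ℝ => fun i k : Fin m => (z ^ (w * ex i))⁻¹ *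
      (∑ l : Fin (K₁ + 2), (z ^ w) ^ (d l - d 0) * (Uᵀ * S l * U) i k +
        ∑ l : Fin (K₂ + 1), ((z ^ w) ^ a * ((z ^ g)⁻¹ * v) ^ (e l.succ - e 0)) * (Uᵀ * T l.succ * U) i k)) atTop
      (𝓝 (fun i k : Fin m => if lam i = 0
          then (Uᵀ * S (Fin.last K₁).castSucc * U) i k + v ^ w * (Uᵀ * T 1 * U) i k
          else (if i = k then lam i else 0))) by
    exact ((continuous_id.matrix_det).tendsto _).comp hN
  rw [tendsto_pi_nhds]
  intro i
  rw [tendsto_pi_nhds]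
  intro k
  -- the two families of terms in the shape `c z^p / z^q`
  have hSterm : ∀ z : ℝ, (z ^ (w * ex i))⁻¹ * (∑ l : Fin (K₁ + 2), (z ^ w) ^ (d l - d 0) * (Uᵀ * S l * U) i k) =
      ∑ l : Fin (K₁ + 2), (Uᵀ * S l * U) i k * z ^ (w * (d l - d 0)) * (z ^ (w * ex i))⁻¹ := by
    intro z
    rw [Finset.mul_sum]
    refine Finset.sum_congr rfl fun l _ => ?_
    rw [← pow_mul]
    ring
  have hTterm : ∀ z : ℝ, (z ^ (w * ex i))⁻¹ *
      (∑ l : Fin (K₂ + 1), ((z ^ w) ^ a * ((z ^ g)⁻¹ * v) ^ (e l.succ - e 0)) * (Uᵀ * T l.succ * U) i k) =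
      ∑ l : Fin (K₂ + 1), ((Uᵀ * T l.succ * U) i k * v ^ (e l.succ - e 0)) * z ^ (w * a) *
        (z ^ (w * ex i + g * (e l.succ - e 0)))⁻¹ := by
    intro z
    rw [Finset.mul_sum]
    refine Finset.sum_congr rfl fun l _ => ?_
    rw [mul_pow, inv_pow, ← pow_mul, ← pow_mul, pow_add, mul_inv]
    ring
  have hsplit : ∀ z : ℝ, (z ^ (w * ex i))⁻¹ *
      (∑ l : Fin (K₁ + 2), (z ^ w) ^ (d l - d 0) * (Uᵀ * S l * U) i k +
        ∑ l : Fin (K₂ + 1), ((z ^ w) ^ a * ((z ^ g)⁻¹ * v) ^ (e l.succ - e 0)) * (Uᵀ * T l.succ * U) i k) =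
      (∑ l : Fin (K₁ + 2), (Uᵀ * S l * U) i k * z ^ (w * (d l - d 0)) * (z ^ (w * ex i))⁻¹) +
      ∑ l : Fin (K₂ + 1), ((Uᵀ * T l.succ * U) i k * v ^ (e l.succ - e 0)) * z ^ (w * a) *
        (z ^ (w * ex i + g * (e l.succ - e 0)))⁻¹ := by
    intro z
    rw [mul_add, hSterm, hTterm]
  refine Tendsto.congr (fun z => (hsplit z).symm) ?_
  -- limits of the `S`-terms
  have hS : Tendsto (fun z : ℝ => ∑ l : Fin (K₁ + 2), (Uᵀ * S l * U) i k * z ^ (w * (d l - d 0)) *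
      (z ^ (w * ex i))⁻¹) atTop
      (𝓝 (∑ l : Fin (K₁ + 2), if w * (d l - d 0) = w * ex i then (Uᵀ * S l * U) i k else 0)) := by
    refine tendsto_finsetSum _ fun l _ => tendsto_term _ _ _ ?_
    by_cases hl : l = Fin.last (K₁ + 1)
    · by_cases hli : lam i = 0
      · right
        rw [hl, hdiag, diagonal_apply]
        split_ifs <;> simp [hli]
      · left
        rw [hl, hex]
        simp only [hli, ↓reduceIte]
        exact le_rfl
    · left
      have hlt : l < Fin.last (K₁ + 1) := lt_of_le_of_ne (Fin.le_last l) hl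
      have hle : l ≤ (Fin.last K₁).castSucc := by
        rcases Fin.eq_castSucc_or_eq_last l with ⟨l', rfl⟩ | h
        · exact Fin.castSucc_le_castSucc_iff.2 (Fin.le_last l')
        · exact absurd h hl
      have h1 : d l - d 0 ≤ a' := Nat.sub_le_sub_right (hd.monotone hle) _
      have h2 : a' ≤ ex i := by rw [hex]; simp only; split_ifs <;> omega
      exact Nat.mul_le_mul_left _ (h1.trans h2)
  -- limits of the `T`-terms
  have hT : Tendsto (fun z : ℝ => ∑ l : Fin (K₂ + 1), ((Uᵀ * T l.succ * U) i k * v ^ (e l.succ - e 0)) *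
      z ^ (w * a) * (z ^ (w * ex i + g * (e l.succ - e 0)))⁻¹) atTop
      (𝓝 (∑ l : Fin (K₂ + 1), if w * a = w * ex i + g * (e l.succ - e 0)
        then (Uᵀ * T l.succ * U) i k * v ^ (e l.succ - e 0) else 0)) := by
    refine tendsto_finsetSum _ fun l _ => tendsto_term _ _ _ (Or.inl ?_)
    have hwl : w ≤ e l.succ - e 0 := by
      have : e 1 ≤ e l.succ := he.monotone (by
        change ((0 : Fin (K₂ + 1)).succ) ≤ l.succ
        exact Fin.succ_le_succ_iff.2 (Fin.zero_le l))
      exact Nat.sub_le_sub_right this _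
    rw [hex]
    simp only
    split_ifs
    · rw [haa', mul_add]
      have := Nat.mul_le_mul_left g hwl
      nlinarith [mul_comm w g]
    · nlinarith
  -- identify the limits with the entries of `N∞`
  have hSlim : (∑ l : Fin (K₁ + 2), if w * (d l - d 0) = w * ex i then (Uᵀ * S l * U) i k else 0) =
      if lam i = 0 then (Uᵀ * S (Fin.last K₁).castSucc * U) i k else (if i = k then lam i else 0) := by
    by_cases hli : lam i = 0
    · rw [if_pos hli, Finset.sum_eq_single_of_mem (Fin.last K₁).castSucc (mem_univ _)]
      · rw [if_pos (by simp only [hex, hli, ha', ↓reduceIte])]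
      · intro l _ hl
        rw [if_neg]
        intro hc
        have hc' : d l - d 0 = ex i := Nat.eq_of_mul_eq_mul_left hw0 hc
        rw [hex] at hc'; simp only [hli, ↓reduceIte] at hc'
        have h0l : d 0 ≤ d l := hd.monotone (Fin.zero_le l)
        have h0l' : d 0 ≤ d (Fin.last K₁).castSucc := hd.monotone (Fin.zero_le _)
        have : d l = d (Fin.last K₁).castSucc := by omega
        exact hl (hd.injective this)
    · rw [if_neg hli, Finset.sum_eq_single_of_mem (Fin.last (K₁ + 1)) (mem_univ _)]
      · rw [if_pos (by simp only [hex, hli, ha, ↓reduceIte]), hdiag, diagonal_apply]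
      · intro l _ hl
        rw [if_neg]
        intro hc
        have hc' : d l - d 0 = ex i := Nat.eq_of_mul_eq_mul_left hw0 hc
        rw [hex] at hc'; simp only [hli, ↓reduceIte] at hc'
        have h0l : d 0 ≤ d l := hd.monotone (Fin.zero_le l)
        have h0l' : d 0 ≤ d (Fin.last (K₁ + 1)) := hd.monotone (Fin.zero_le _)
        have : d l = d (Fin.last (K₁ + 1)) := by omega
        exact hl (hd.injective this)
  have hTlim : (∑ l : Fin (K₂ + 1), if w * a = w * ex i + g * (e l.succ - e 0)
      then (Uᵀ * T l.succ * U) i k * v ^ (e l.succ - e 0) else 0) =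
      if lam i = 0 then v ^ w * (Uᵀ * T 1 * U) i k else 0 := by
    by_cases hli : lam i = 0
    · rw [if_pos hli, Finset.sum_eq_single_of_mem (0 : Fin (K₂ + 1)) (mem_univ _)]
      · rw [if_pos]
        · rw [Fin.succ_zero_eq_one, mul_comm]
        · rw [hex]; simp only [hli, ↓reduceIte]; rw [haa', Fin.succ_zero_eq_one, ← hw]; ring
      · intro l _ hl
        rw [if_neg]
        rw [hex]; simp only [hli, ↓reduceIte]
        have hlt : w < e l.succ - e 0 := by
          have h1 : (1 : Fin (K₂ + 2)) < l.succ := by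
            change ((0 : Fin (K₂ + 1)).succ) < l.succ
            exact Fin.succ_lt_succ_iff.2 (Fin.pos_of_ne_zero hl)
          have h2 : e 1 < e l.succ := he h1
          have h3 : e 0 ≤ e 1 := he.monotone (by simp)
          rw [hw]; omega
        rw [haa', mul_add]
        have := Nat.mul_lt_mul_of_pos_left hlt hg0
        nlinarith [mul_comm w g]
    · rw [if_neg hli]
      refine Finset.sum_eq_zero fun l _ => ?_
      rw [if_neg]
      rw [hex]; simp only [hli, ↓reduceIte]
      have h1 : 0 < e l.succ - e 0 := Nat.sub_pos_of_lt (he (Fin.succ_pos l))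
      nlinarith [Nat.mul_pos hg0 h1]
  have hlim := hS.add hT
  rw [hSlim, hTlim] at hlim
  convert hlim using 2
  split_ifs <;> ring

end Seam

end Summit.ValiantsHypothesis.ValiantsHypothesis.Theorems.LacunarySymmetroidMatrixDescartes.JunctionCeiling
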